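import Literature.Barriers.RiemannHypothesis.DeBrangesPositivity
import Literature.NumberTheory.LFunctions.DirichletLThetaRepresentation
import HarnessLib

/-!
# Barrier: de Branges' positivity conditions fail for Dirichlet `L`-functions (Conrey–Li 2000, §3.2 and §4)

LABEL (line 1): RH-FREE NEGATIVE results (refutations printed in a refereed paper) about the
de Branges approach to the generalized Riemann hypothesis. bears_on: B-C/B-P (LADDER-RH §1,
COLUMN 6 DBR). WHAT THIS IS NOT: not progress toward RH or GRH in either direction — these are the
printed FAILURES of de Branges' sufficient conditions (3.7)/(3.8) for `L(s, χ₄)` and, for the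
`𝓕(W_χ)` condition, for every Dirichlet character `χ` (P. Sarnak); nothing here bears on the truth
of RH.

Barrier catalogue `Literature/Barriers/RiemannHypothesis/` (D-0021), entry
`DeBrangesPositivityDirichlet` (namespace `Literature.Barriers.RiemannHypothesis`): the companion of
`DeBrangesPositivity.lean` (the `ζ` entry, whose three components `ConreyLi2000_HE`,
`ConreyLi2000_FW_numeric`, `ConreyLi2000_FW` are all PROVED in the tree), which records the
Dirichlet-character failures "only informally". Here they are typed AS PRINTED.

J. B. Conrey, X.-J. Li, *A note on some positivity conditions related to zeta and L-functions*,
IMRN 2000:18, 929–940 = arXiv:math/9812166 (read: §3.2 "The Dirichlet L-function `L(s, χ₄)`",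
arXiv pp. 3–4 = held text p0003:L111–p0004:L58, and §4 "Conclusion" with the Remark, p0004:L60–102).

## The printed text

§3.2 (p. 3): `χ₄(n) = (−1)^{(n−1)/2}` (`n` odd), `0` (`n` even) — "the real primitive Dirichlet
character (mod 4)"; `ξ(s, χ₄) = (4/π)^{s/2} Γ((1+s)/2) L(s, χ₄)`, entire, `ξ(1−s, χ₄) = ε(χ₄) ξ(s, χ₄)`
(3.5), `ξ(s, χ₄) = (√π/2) ∏ (1 − s/ρ)` (3.6); `E_{χ₄}(z) = ξ(1 − iz, χ₄)` satisfies the hypotheses of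
Theorem 1. (p. 4): "Let `ρ = 1/2 + i67.6369208635460683980549…` be a zero of `L(s, χ₄)`. By using
MATHEMATICA, we compute that `−Re{ξ′(ρ, χ₄) ξ(1+ρ, χ₄)} = −2.310349004993483456…×10⁻⁴⁵ < 0`. …
Therefore, by Theorem 1, … `𝓗(E_{χ₄})` … does not satisfy the condition (3.7)." and "By using
MATHEMATICA, we compute that `Re{ξ(1+i8714.2, χ₄)/ξ(2+i8714.2, χ₄)} = −0.000422340607 < 0`. Let
`w = −8714.2`. Then `Im w = 0 > −1/2` … `Re{W_{χ₄}(w)/W_{χ₄}(w+i)} < 0`. Therefore, by Theorem 2, …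
`𝓕(W_{χ₄})` with `W_{χ₄}(z) = 1/ξ(1−iz, χ₄)` does not satisfy the condition (3.8)."

§4 Remark (p. 4): Sarnak's numerics-free proof for `ζ` (tree: `ConreyLi2000_FW_holds`), then: "Let
`r` be any positive integer. For any Dirichlet character `χ` modulo `r`, let
`ξ(s, χ) = (π/r)^{−(s+a)/2} Γ((s+a)/2) L(s, χ)` where … `a = 0` if `χ(−1) = 1` and `a = 1` if
`χ(−1) = −1`. By using a similar argument, Peter Sarnak also proved that the space `𝓕(W_χ)` does not
satisfy the condition (3.8) where `W_χ(z) = 1/ξ(1 − iz, χ)`."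

## Rendering (GUARD-CONREYLI R1/R3: normalisations and half-planes declared)

* `ξ(s, χ)` of §4 is EXACTLY the tree's `Literature.NumberTheory.LFunctions.DirichletTheta.dirichletXi χ s`
  `= r^{(s+a)/2} Λ(s, χ)` `= (r/π)^{(s+a)/2} Γ((s+a)/2) L(s, χ)` (Montgomery–Vaughan (10.19);
  `a = Literature.NumberTheory.LFunctions.charParity χ`). The §3.2 normalisation differs by a
  positive constant: `ξ(s, χ₄)_{§3.2} = (4/π)^{s/2} Γ((1+s)/2) L(s, χ₄) = (√π/2) · dirichletXi χ₄ s`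
  (`a = 1`, `r = 4`); a ratio `ξ(s)/ξ(s+1)` is unchanged, a product `ξ′(ρ) ξ(1+ρ)` scales by `π/4 > 0`,
  so every printed sign is the sign of the `dirichletXi` expression.
* `χ₄` is "the primitive character mod 4": the statements quantify `∀ χ : DirichletCharacter ℂ 4,
  χ.IsPrimitive → …` (there is exactly one such `χ`; its values are Mathlib's `ZMod.χ₄`, tree:
  `Literature.NumberTheory.LFunctions.…apply_natCast_four_eq`).
* §3.2's necessary condition of Theorem 1 at a zero `w` of `E_{χ₄}(z) = ξ(1 − iz, χ₄)`, `ρ = 1 − iw`: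
  `Re{Ē′(w) E(w+i)/2πi} = Re{conj(ξ′(ρ, χ₄)) ξ(1+ρ, χ₄)}/(2π)`, typed with the value conjugation as in
  the `ζ` entry `ConreyLi2000_HE`; on the critical line `ξ(·, χ₄)` is real (`χ₄` real, `ε(χ₄) = 1`),
  so `conj ξ′(ρ, χ₄) = −ξ′(ρ, χ₄)` and this is the printed `−Re{ξ′(ρ, χ₄) ξ(1+ρ, χ₄)}`.
* The half-plane dictionary of Theorem 2 (`s = 1 − iz`): `Im z > −1/2 ⟺ Re s > 1/2`,
  `W_χ(z)/W_χ(z+i) = ξ(s+1, χ)/ξ(s, χ)`, and `Re u < 0 ⟺ Re u⁻¹ < 0`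
  (`ConreyLi2000_FW_char.not_necessary`).

## What this file vendors

* `ConreyLi2000_HE_chi4` — §3.2, the `𝓗(E_{χ₄})` failure at the zero `1/2 + i67.6369…` (numerical
  evaluation as printed; a named fact until certified numerics are run — none here).
* `ConreyLi2000_FW_chi4_numeric` — §3.2, `Re{ξ(1+8714.2i, χ₄)/ξ(2+8714.2i, χ₄)} < 0` (numerical, as
  printed; named fact).
* `ConreyLi2000_FW_char` — §4 Remark, Sarnak: for every `r ≥ 1` and every Dirichlet character `χ`
  mod `r` there is `s₀` with `Re s₀ > 1/2` and `Re{ξ(s₀, χ)/ξ(s₀+1, χ)} < 0` (the `𝓕(W_χ)` failure).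
  Named fact here; its discharge `ConreyLi2000_FW_char_holds` follows the tree's proof of
  `ConreyLi2000_FW_holds` (Kronecker alignment of the phases `χ(p)p^{−it}`, divergence of
  `∑_{p ∤ r} 1/p`) in the sibling `DeBrangesPositivityDirichletProofs.lean`.
* `DeBrangesPositivityDirichlet` — the catalogued conjunction, with the D-0021 block.
* Proved: `ConreyLi2000_FW_char.not_necessary`, `ConreyLi2000_FW_char_four_of_numeric`,
  `DeBrangesPositivityDirichlet_of_components`.

## References

* [ConreyLi2000] J. B. Conrey, X.-J. Li, IMRN 2000:18, 929–940 = arXiv:math/9812166, §3.2, §4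
  (read, arXiv pp. 3–4).
* [MontgomeryVaughan2007] H. L. Montgomery, R. C. Vaughan, *Multiplicative Number Theory I*,
  (10.19) (the completed `ξ(s, χ)`; tree `dirichletXi`).
* [Titchmarsh1986] E. C. Titchmarsh, *The Theory of the Riemann Zeta-function*, 2nd ed., Ch. XI
  (the density theorem Conrey–Li cite for Sarnak's argument; for `χ` no source is printed).
-/

noncomputable section

open Complex
open scoped ComplexConjugate

open Literature.NumberTheory.LFunctions Literature.NumberTheory.LFunctions.DirichletTheta

namespace Literature.Barriers.RiemannHypothesis

/-- **Conrey–Li 2000, §3.2: de Branges' `𝓗(E)`-positivity (3.7) fails for `L(s, χ₄)`.** For the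
primitive character `χ₄` mod `4` there is a zero `ρ` of `ξ(·, χ₄)` on the critical line with
ordinate in `(67.63, 67.64)` — the paper's `ρ = 1/2 + i67.6369208635460683980549…`, "a zero of
`L(s, χ₄)`" — at which `Re{conj(ξ′(ρ, χ₄)) · ξ(1+ρ, χ₄)} < 0`; as printed,
`−Re{ξ′(ρ, χ₄) ξ(1+ρ, χ₄)} = −2.310349004993483456…×10⁻⁴⁵ < 0` (MATHEMATICA evaluation; on the
critical line `conj ξ′(ρ, χ₄) = −ξ′(ρ, χ₄)`, and the sign is that of the expression in the tree's
normalisation `ξ(·, χ₄) = dirichletXi χ₄ = (2/√π)·ξ(·, χ₄)_{printed}`). By Conrey–Li's Theorem 1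
(de Branges; tree `Literature.Analysis.DeBrangesSpaces.conreyLi2000_thm1`) applied to
`E_{χ₄}(z) = ξ(1 − iz, χ₄)`, condition (3.7) would force this real part to be `≥ 0` at every zero,
so (3.7) fails. Numerical fact, not certified here. [cite: ConreyLi2000, §3.2] -/
def ConreyLi2000_HE_chi4 : Prop :=
  ∀ χ : DirichletCharacter ℂ 4, χ.IsPrimitive →
    ∃ ρ : ℂ, dirichletXi χ ρ = 0 ∧ ρ.re = 1 / 2 ∧ (67.63 : ℝ) < ρ.im ∧ ρ.im < (67.64 : ℝ) ∧
      (conj (deriv (dirichletXi χ) ρ) * dirichletXi χ (1 + ρ)).re < 0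

/-- **Conrey–Li 2000, §3.2: the printed numerical witness against `𝓕(W_{χ₄})`-positivity (3.8).**
`Re{ξ(1 + i8714.2, χ₄)/ξ(2 + i8714.2, χ₄)} = −0.000422340607 < 0` (MATHEMATICA evaluation as printed;
the ratio is the same in the tree's normalisation `dirichletXi`). With `w = −8714.2` (`Im w = 0 > −1/2`),
`W_{χ₄}(w) = 1/ξ(1+i8714.2, χ₄)`, `W_{χ₄}(w+i) = 1/ξ(2+i8714.2, χ₄)`, so `Re{W_{χ₄}(w)/W_{χ₄}(w+i)} < 0`
and, by Conrey–Li's Theorem 2 (tree `Literature.Analysis.DeBrangesSpaces.conreyLi2000_thm2`), the space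
`𝓕(W_{χ₄})` does not satisfy (3.8). Numerical fact, not certified here. [cite: ConreyLi2000, §3.2] -/
def ConreyLi2000_FW_chi4_numeric : Prop :=
  ∀ χ : DirichletCharacter ℂ 4, χ.IsPrimitive →
    (dirichletXi χ (1 + (8714.2 : ℝ) * I) / dirichletXi χ (2 + (8714.2 : ℝ) * I)).re < 0

/-- **Conrey–Li 2000, §4 Remark (P. Sarnak): de Branges' `𝓕(W_χ)`-positivity (3.8) fails for every
Dirichlet `L`-function.** "Let `r` be any positive integer. For any Dirichlet character `χ` modulo `r`,
let `ξ(s, χ) = (π/r)^{−(s+a)/2} Γ((s+a)/2) L(s, χ)` … [`a` the parity]. By using a similar argument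
[to the one for `ζ`: `Im log(ξ(s)/ξ(s+1)) = Im log ζ(s) + O(1)` and density of the values of
`log ζ(s)`, `1/2 < Re s < 2`], Peter Sarnak also proved that the space `𝓕(W_χ)` does not satisfy the
condition (3.8) where `W_χ(z) = 1/ξ(1 − iz, χ)`." Typed, as for the `ζ` entry `ConreyLi2000_FW`, as
the failure of the necessary condition of Theorem 2 in the variable `s = 1 − iz`: there is `s₀`
with `Re s₀ > 1/2` and `Re{ξ(s₀, χ)/ξ(s₀+1, χ)} < 0` (`ξ(·, χ) = dirichletXi χ`, exactly the printed
normalisation). Discharged in `DeBrangesPositivityDirichletProofs.lean` (Kronecker's theorem for the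
phases `χ(p) p^{−it}` and `∑_{p ∤ r} 1/p = ∞`, as in the tree's proof of `ConreyLi2000_FW_holds`).
[cite: ConreyLi2000, §4 Remark] -/
def ConreyLi2000_FW_char : Prop :=
  ∀ (r : ℕ) [NeZero r] (χ : DirichletCharacter ℂ r),
    ∃ s₀ : ℂ, 1 / 2 < s₀.re ∧ (dirichletXi χ s₀ / dirichletXi χ (s₀ + 1)).re < 0

/-- The numerical witness of §3.2 gives Sarnak's statement for the primitive character mod `4`, with
`s₀ = 1 + 8714.2i`. [cite: ConreyLi2000, §3.2] -/
theorem ConreyLi2000_FW_char_four_of_numeric (h : ConreyLi2000_FW_chi4_numeric)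
    (χ : DirichletCharacter ℂ 4) (hχ : χ.IsPrimitive) :
    ∃ s₀ : ℂ, 1 / 2 < s₀.re ∧ (dirichletXi χ s₀ / dirichletXi χ (s₀ + 1)).re < 0 := by
  refine ⟨1 + (8714.2 : ℝ) * I, ?_, ?_⟩
  · norm_num
  · have e : (1 : ℂ) + (8714.2 : ℝ) * I + 1 = 2 + (8714.2 : ℝ) * I := by ring
    rw [e]
    exact h χ hχ

/-- Unfolding: the necessary condition of Conrey–Li's Theorem 2 for `W_χ = 1/ξ(1 − iz, χ)`, written in
the variable `s = 1 − iz` (`Im z > −1/2 ⟺ Re s > 1/2`, `W_χ(z)/W_χ(z+i) = ξ(s+1, χ)/ξ(s, χ)`), is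
refuted by `ConreyLi2000_FW_char` for every character: `Re u < 0 → Re u⁻¹ < 0`.
[cite: ConreyLi2000, Theorem 2 and §4 Remark] -/
theorem ConreyLi2000_FW_char.not_necessary (h : ConreyLi2000_FW_char) {r : ℕ} [NeZero r]
    (χ : DirichletCharacter ℂ r) :
    ¬ ∀ s : ℂ, 1 / 2 < s.re → 0 ≤ (dirichletXi χ (s + 1) / dirichletXi χ s).re := by
  obtain ⟨s₀, hs₀, hneg⟩ := h r χ
  intro H
  have h1 := H s₀ hs₀
  rw [← inv_div, Complex.inv_re] at h1
  have hpos : 0 < Complex.normSq (dirichletXi χ s₀ / dirichletXi χ (s₀ + 1)) := by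
    rw [Complex.normSq_pos]
    intro h0
    rw [h0] at hneg
    simp at hneg
  rcases div_nonneg_iff.mp h1 with ⟨ha, _⟩ | ⟨_, hb⟩
  · linarith
  · linarith

/-! ## The barrier -/

/-- **Barrier `DeBrangesPositivityDirichlet` (Conrey–Li 2000, §3.2 and §4).** de Branges' positivity
conditions, which would give the generalized Riemann hypothesis for Dirichlet `L`-functions, fail:
condition (3.7) for `𝓗(E_{χ₄})`, `E_{χ₄}(z) = ξ(1 − iz, χ₄)` (`ConreyLi2000_HE_chi4`, via the necessary
condition of Theorem 1 at the zero `1/2 + i67.6369…`), and condition (3.8) for `𝓕(W_χ)`,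
`W_χ(z) = 1/ξ(1 − iz, χ)`, for EVERY Dirichlet character `χ` (`ConreyLi2000_FW_char`, Sarnak, via the
necessary condition of Theorem 2; printed numerical witness for `χ₄`: `ConreyLi2000_FW_chi4_numeric`).
"We have seen in section 3 the difficulty of approaching the generalized Riemann hypothesis by using
de Branges type positivity conditions for reproducing kernel Hilbert spaces" (§4). The `ζ` entry is
`DeBrangesPositivity` (all components proved).

BARRIER (structured block, D-0021):
- technique_class: de-Branges-positivity Hilbert-space-of-entire-functions reproducing-kernel-positivity (Dirichlet `L`-functions)
- blocks: GRH for `L(s, χ₄)` via de Branges' Theorem 1 applied to `E_{χ₄}(z) = ξ(1 − iz, χ₄)` (condition (3.7)) [cite: ConreyLi2000, §3.2]; `L(s, χ) ≠ 0` on `Re s > 1/2` via de Branges' Theorem 2 applied to `W_χ(z) = 1/ξ(1 − iz, χ)` (condition (3.8)), for every Dirichlet character `χ` mod `r ≥ 1` [cite: ConreyLi2000, §3.2 and §4 Remark]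
- because: Theorem 1's hypothesis implies `Re{conj(E′(w))E(w+i)/2πi} ≥ 0` at each zero `w` of `E_{χ₄}`, negative at the zero `ρ = 1/2 + i67.6369…` of `L(s, χ₄)` (`−2.3103…·10⁻⁴⁵`) [cite: ConreyLi2000, Thm. 1 and §3.2]; Theorem 2's hypothesis implies `Re{W_χ(z)/W_χ(z+i)} ≥ 0` on `Im z > −1/2`, false at `z = −8714.2` for `χ₄` (`−0.000422…`) and false for every `χ` by Sarnak's density/Kronecker argument [cite: ConreyLi2000, Thm. 2, §3.2 and §4 Remark]
- evasions_known: none published; de Branges spaces satisfying the inner-product conditions of de Branges 1986 do exist for other structure functions (Li 2000) [cite: Lagarias2005, §7]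
- scope_caveats: refutes the printed sufficient conditions (3.7) (for `χ₄` only — other characters' `𝓗(E_χ)` conditions are not examined in print) and (3.8) (all `χ`), not every Hilbert-space-of-entire-functions formulation [cite: ConreyLi2000, §4]; the two `χ₄` numerics are MATHEMATICA evaluations, uncertified here
- status: established (refereed; the all-`χ` `𝓕`-failure has Sarnak's non-numerical proof, formalised in the sibling Proofs file) [cite: ConreyLi2000, §4 Remark]

[cite: ConreyLi2000, §3.2 and §4] -/
def DeBrangesPositivityDirichlet : Prop :=
  ConreyLi2000_HE_chi4 ∧ ConreyLi2000_FW_char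

/-- The catalogued barrier from its two printed components. [cite: ConreyLi2000, §3.2 and §4] -/
theorem DeBrangesPositivityDirichlet_of_components (h₁ : ConreyLi2000_HE_chi4)
    (h₂ : ConreyLi2000_FW_char) : DeBrangesPositivityDirichlet :=
  ⟨h₁, h₂⟩

end Literature.Barriers.RiemannHypothesis

end
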